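import Literature.NumberTheory.GaloisRepresentations.TeichmullerLiftMonomial
import HarnessLib

/-!
# Stub E `stub_oddOfConjugationTrace`
(line `birth`, crux `AdjointSeedFromDuality`, stmt-Langlands-16780)

Parity.  Let `k = ℤ̄_p/𝔪 = padicAlgClResidueField p` with `2 ≠ 0` in `k`, let
`ρ : Γ_ℚ → GL₃(ℚ̄_p)` have a reduction `ρ̄ : Γ_ℚ → GL₃(k)`, and let `τ̄ : Γ_ℚ → GL₂(k)`,
`ψ̄ : Γ_ℚ → kˣ` satisfy the trace identity `tr ρ̄(σ) = ψ̄(σ) (tr τ̄(σ)² / det τ̄(σ) − 1)`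
(`ρ̄ ≅ ψ̄ ⊗ ad⁰ τ̄` in trace form).  If `c` is a complex conjugation with `tr ρ(c) = ±1`, then
`det τ̄(c) = −1`.

Proof.  The trace of a reduction at `c` is the residue of the trace of an integral model at `c`,
which coerces to `tr ρ(c) = ±1` (conjugation invariance of the trace); so `tr ρ̄(c) = ±1` and
`tr ρ̄(c)² = 1` in `k`.  From `c² = 1`: `τ̄(c)² = 1`, `ψ̄(c)² = 1`, `det τ̄(c) = ±1`.  If
`det τ̄(c) = 1` then `τ̄(c) = ±1` (`eq_one_or_eq_neg_one_of_mul_self_eq_one`, `2 ≠ 0`), so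
`tr τ̄(c)² = 4` and the trace identity reads `tr ρ̄(c) = 3 ψ̄(c)`; squaring gives `1 = 9`, i.e.
`8 = 0` in `k`, contradicting `2 ≠ 0`.
-/

set_option linter.dupNamespace false -- `Summit.Langlands.Langlands` is the mandated namespace

namespace Summit.Langlands.Langlands.Cruxes.AdjointSeedFromDuality.Birth

open scoped MatrixGroups
open Literature.NumberTheory.GaloisRepresentations

/-- **Trace of an integral model.**  If `ρ₀ : G → GL_n(ℤ̄_p)` is an integral model of
`ρ : G → GL_n(ℚ̄_p)` in the frame `P` (`ρ₀(g) = P⁻¹ ρ(g) P`), then `tr ρ₀(g)`, coerced to `ℚ̄_p`,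
is `tr ρ(g)` (the trace is invariant under conjugation). [folklore] -/
private theorem coe_trace_integralModel {p : ℕ} [Fact p.Prime] {G : Type*} [Group G] {n : ℕ}
    {ρ : G →* GL (Fin n) (PadicAlgCl p)} {ρ₀ : G →* GL (Fin n) (padicAlgClIntegers p)}
    {P : GL (Fin n) (PadicAlgCl p)}
    (hP : ∀ g, Matrix.GeneralLinearGroup.map (padicAlgClIntegers p).subtype (ρ₀ g) = P⁻¹ * ρ g * P)
    (g : G) :
    ((((ρ₀ g : GL (Fin n) (padicAlgClIntegers p)) :
        Matrix (Fin n) (Fin n) (padicAlgClIntegers p)).trace : padicAlgClIntegers p) :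
        PadicAlgCl p) =
      ((ρ g : GL (Fin n) (PadicAlgCl p)) : Matrix (Fin n) (Fin n) (PadicAlgCl p)).trace := by
  have h1 : (((ρ₀ g : GL (Fin n) (padicAlgClIntegers p)) :
      Matrix (Fin n) (Fin n) (padicAlgClIntegers p)).map (padicAlgClIntegers p).subtype).trace =
      ((ρ g : GL (Fin n) (PadicAlgCl p)) : Matrix (Fin n) (Fin n) (PadicAlgCl p)).trace := by
    have h := congrArg
      (fun A : GL (Fin n) (PadicAlgCl p) => (A : Matrix (Fin n) (Fin n) (PadicAlgCl p)).trace)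
      (hP g)
    simp only [Units.val_mul, Matrix.trace_units_conj'] at h
    exact h
  rw [← h1]
  exact AddMonoidHom.map_trace (padicAlgClIntegers p).subtype _

/-- **Trace of a reduction.**  If `ρ̄(g) = Q (ρ₀(g) mod 𝔪) Q⁻¹`, then `tr ρ̄(g)` is the residue of
`tr ρ₀(g)`. [folklore] -/
private theorem trace_eq_residue_trace {p : ℕ} [Fact p.Prime] {G : Type*} [Group G] {n : ℕ}
    {ρ₀ : G →* GL (Fin n) (padicAlgClIntegers p)}
    {τ : G →* GL (Fin n) (padicAlgClResidueField p)} {Q : GL (Fin n) (padicAlgClResidueField p)}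
    (hQ : ∀ g, τ g = Q * integralReduction (RingHom.id (padicAlgClResidueField p)) ρ₀ g * Q⁻¹)
    (g : G) :
    ((τ g : GL (Fin n) (padicAlgClResidueField p)) :
        Matrix (Fin n) (Fin n) (padicAlgClResidueField p)).trace =
      IsLocalRing.residue (padicAlgClIntegers p)
        ((ρ₀ g : GL (Fin n) (padicAlgClIntegers p)) :
          Matrix (Fin n) (Fin n) (padicAlgClIntegers p)).trace := by
  rw [hQ g, Units.val_mul, Units.val_mul, Matrix.trace_units_conj]
  simp only [Matrix.trace, Matrix.diag_apply, integralReduction_apply_coe, RingHom.id_apply,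
    map_sum]

/-- **STUB E — parity: a trace-`±1` complex conjugation forces the `GL₂` seed to be odd.**
For `ρ : Γ_ℚ → GL₃(ℚ̄_p)` with a reduction `ρ̄`, and `τ̄`, `ψ̄` with
`tr ρ̄ = ψ̄ · (tr τ̄² / det τ̄ − 1)` over `k = ℤ̄_p/𝔪` with `2 ≠ 0`: if `c` is a complex conjugation
with `tr ρ(c) = ±1` then `det τ̄(c) = −1`.  Indeed `tr ρ̄(c) = ±1` in `k` (trace of a reduction is
the reduction of the trace); `c² = 1` so `τ̄(c)` and `ψ̄(c)` are involutions and `det τ̄(c) = ±1`;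
`det τ̄(c) = 1` would make `τ̄(c) = ±1`, so `tr τ̄(c)²/det τ̄(c) − 1 = 3` and `tr ρ̄(c) = 3 ψ̄(c)`,
whence `1 = tr ρ̄(c)² = 9 ψ̄(c)² = 9`, i.e. `8 = 0` in `k`, contradicting `2 ≠ 0`. [folklore] -/
theorem stub_oddOfConjugationTrace (p : ℕ) [Fact p.Prime] (h2 : (2 : padicAlgClResidueField p) ≠ 0)
    (ρ : FramedGaloisRep ℚ (PadicAlgCl p) 3)
    (ρbar : Field.absoluteGaloisGroup ℚ →* GL (Fin 3) (padicAlgClResidueField p))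
    (τbar : Field.absoluteGaloisGroup ℚ →* GL (Fin 2) (padicAlgClResidueField p))
    (ψbar : Field.absoluteGaloisGroup ℚ →* (padicAlgClResidueField p)ˣ)
    (hred : ρ.IsReductionOf (RingHom.id (padicAlgClResidueField p)) ρbar)
    (had : ∀ σ, (ρbar σ).val.trace =
      (ψbar σ).val * ((τbar σ).val.trace ^ 2 * ((τbar σ).val.det)⁻¹ - 1))
    (φ : ℚ →+* ℝ) (c : Field.absoluteGaloisGroup ℚ) (hc : IsComplexConjugation φ c)
    (htr : (ρ c).val.trace = 1 ∨ (ρ c).val.trace = -1) :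
    Matrix.GeneralLinearGroup.det (τbar c) = -1 := by
  -- Step 1: `tr ρ̄(c) = ±1` in `k`, hence `tr ρ̄(c)² = 1`.
  obtain ⟨ρ₀, Q, ⟨P, hP⟩, hQ⟩ := hred
  have ht₀F := coe_trace_integralModel hP c
  have ht₀ : ((ρ₀ c : GL (Fin 3) (padicAlgClIntegers p)) :
        Matrix (Fin 3) (Fin 3) (padicAlgClIntegers p)).trace = 1 ∨
      ((ρ₀ c : GL (Fin 3) (padicAlgClIntegers p)) :
        Matrix (Fin 3) (Fin 3) (padicAlgClIntegers p)).trace = -1 := by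
    change ((_ : padicAlgClIntegers p) : PadicAlgCl p) = (ρ c).val.trace at ht₀F
    rw [← ht₀F] at htr
    rcases htr with h | h
    · exact Or.inl (by exact_mod_cast h)
    · exact Or.inr (by exact_mod_cast h)
  have htrbar := trace_eq_residue_trace hQ c
  have ht2 : (ρbar c).val.trace * (ρbar c).val.trace = 1 := by
    rw [htrbar]
    rcases ht₀ with h | h <;> rw [h] <;> simp
  -- Step 2: `c² = 1`, so `τ̄(c)`, `ψ̄(c)` are involutions and `det τ̄(c) = ±1`.
  have hτ2 : τbar c * τbar c = 1 := by rw [← map_mul, ← sq, hc.sq_eq_one, map_one]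
  have hψ2 : (ψbar c).val * (ψbar c).val = 1 := by
    rw [← Units.val_mul, ← map_mul, ← sq, hc.sq_eq_one, map_one, Units.val_one]
  have hM2 : (τbar c).val * (τbar c).val = 1 := by
    rw [← Units.val_mul, hτ2, Units.val_one]
  have hdet2 : (τbar c).val.det * (τbar c).val.det = 1 := by
    rw [← Matrix.det_mul, hM2, Matrix.det_one]
  rcases mul_self_eq_one_iff.mp hdet2 with hdet | hdet
  swap
  · exact Units.ext
      (by rw [Matrix.GeneralLinearGroup.val_det_apply, hdet, Units.val_neg, Units.val_one])
  -- Step 3: `det τ̄(c) = 1` is absurd: `τ̄(c) = ±1`, `tr τ̄(c)² = 4`, `tr ρ̄(c) = 3 ψ̄(c)`,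
  -- `8 = 0`.
  exfalso
  have hM := eq_one_or_eq_neg_one_of_mul_self_eq_one h2 hM2 hdet
  have htrM : (τbar c).val.trace ^ 2 = 4 := by
    rcases hM with h | h <;> rw [h] <;> simp [Matrix.trace_one] <;> norm_num
  have key : (ρbar c).val.trace = (ψbar c).val * 3 := by
    rw [had c, htrM, hdet, inv_one]; ring
  have h8 : (2 : padicAlgClResidueField p) * 2 * 2 = 0 := by
    linear_combination ht2 - ((ρbar c).val.trace + 3 * (ψbar c).val) * key - 9 * hψ2
  exact mul_ne_zero (mul_ne_zero h2 h2) h2 h8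

end Summit.Langlands.Langlands.Cruxes.AdjointSeedFromDuality.Birth
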